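import Summits.AtomisticToContinuum.HydrodynamicLimit.Theorems.BoxDissipativeWeakStrongRelativeEnergyStabilityDefs
import Summits.AtomisticToContinuum.HydrodynamicLimit.Theorems.BoxDissipativeWeakStrongRelativeEnergyStabilityClampChoice
import HarnessLib

/-!
# Crux `RelativeEnergyStability` (stmt-AtomisticToContinuum-17653), line `registered`:
helpers of the stub `stub_clampedRelEnergyTimeZero` (S1') — the pointwise estimate

The deterministic (pointwise in the box state `U = (ρ̂, m̂, Ê)` and the centre `x`) half of S1'
"the clamped box relative energy vanishes at `t = 0`": for the cut hard-sphere law `cutEOS σ η₁` under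
`HsEosLowDensity`, a classical hard-sphere Euler solution `(ρ,u,θ)` on `[0,T)` and clamps `a < b` admissible
at `τ = 0`, Březina–Feireisl's clamped relative energy `ℰ_{Z_{a,b}}(U | (ρ,u,θ)(0,x))`
(`RES.clampedRelEnergy`, BrezinaFeireisl2018 (3.3)–(3.4)) satisfies, for every `ε > 0` and some `K' = K'(ε)`,
`|ℰ_Z| ≤ ε + K' · (|ρ̂ − ρ| + ‖m̂ − ρu‖ + |Ê − E(ρ,u,θ)|)(0,x)` uniformly in `x ∈ 𝕋³` and `U`
(`tz_pointwise_estimate`, registered helper sub-goal). Ingredients: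

* `tz_clampedRelEnergy_eq` — for box states `½|m̂|²/ρ̂ + Ê_int = Ê` identically (junk included), so `ℰ_Z` is
  `Ê − m̂·u + ρ̂(½|u|² − μ_cut) − θ ρ̂ Z(ŝ) + p_cut`: affine in `(m̂, Ê)`, linear growth in `ρ̂`
  (`tz_abs_clampedRelEnergy_le`, `tz_growth`);
* `tz_clampedRelEnergy_self` — `ℰ_Z = 0` at the strong box state `(ρ, ρu, E)` (clamp inactive,
  `μ = e − Θ s + p/ρ`, `e = 3Θ/2`);
* `tz_continuousAt` — joint continuity of `(x, U) ↦ ℰ_Z` at the strong box state (`s_cut`, `μ_cut`, `Z_cut`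
  continuous on the open quadrant under the EOS fact: `cc_continuousOn_s` etc. of the sibling stub S0);
* `tz_uniform_small` — a function vanishing and continuous at the compact graph of a continuous map is
  uniformly small near it (`IsCompact.exists_cthickening_subset_open`); `tz_eps_linear` — growth + local
  smallness give `ε + K'·dev`.

References: BrezinaFeireisl2018 §3.1–3.2; FeireislNovotny2012; Dafermos1979.
-/

noncomputable section

namespace Summit.AtomisticToContinuum.HydrodynamicLimit.Theorems.RES

open MeasureTheory Filter Set
open scoped ENNReal Topology
open Summit.AtomisticToContinuum.HydrodynamicLimit.Theses.BoxDissipativeWeakStrong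
open Literature.MathematicalPhysics.KineticTheory Literature.Analysis.FluidPDE
open Literature.Analysis.FluidPDE.CompressibleEuler
open Literature.Analysis.FluidPDE.CompressibleEuler.EulerPhase

/-! ## Unfolding the cut law -/

/-- The temperature inversion of the cut law: `ϑ(ρ, E_int) = 2E_int/(3ρ)`. -/
theorem tz_temperature_eq (σ η₁ r E : ℝ) : (cutEOS σ η₁).temperature r E = 2 * E / (3 * r) := rfl

/-- The cut pressure unfolded: `p_cut(r,Θ) = rΘ Z_cut(rσ³)`. -/
theorem tz_p_eq (σ η₁ r Θ : ℝ) :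
    (cutEOS σ η₁).p r Θ = r * Θ * cutCompressibility η₁ (r * σ ^ 3) := rfl

/-- The cut internal energy unfolded: `e_cut(r,Θ) = 3Θ/2`. -/
theorem tz_e_eq (σ η₁ r Θ : ℝ) : (cutEOS σ η₁).e r Θ = 3 / 2 * Θ := rfl

/-! ## The clamped relative energy of a box state -/

/-- The clamped relative energy of a box state, unfolded (`½|m̂|²/ρ̂ + Ê_int = Ê` identically,
junk included). -/
theorem tz_clampedRelEnergy_eq (σ η₁ a b r : ℝ) (W : V3) (Θ : ℝ) (U : BoxState) :
    clampedRelEnergy σ η₁ a b r W Θ U =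
      U.2.2 - (∑ i, U.2.1 i * W i) +
        U.1 * (‖W‖ ^ 2 / 2 - (cutEOS σ η₁).chemPotential r Θ) -
        Θ * (U.1 * clamp a b ((cutEOS σ η₁).s U.1
          (2 * (U.2.2 - ‖U.2.1‖ ^ 2 / (2 * U.1)) / (3 * U.1)))) +
        (cutEOS σ η₁).p r Θ := by
  simp only [clampedRelEnergy, StrongPointData.relEnergyZ, boxPhase, strongData, kineticEnergy,
    dens_mk, ien_mk, mom_mk, stateTemp, tz_temperature_eq]
  ring

/-- **Linear growth.** `|ℰ_Z(U | r,W,Θ)| ≤ C (1 + |ρ̂| + ‖m̂‖ + |Ê|)` with `C` depending only on bounds for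
`‖W‖, |μ_cut(r,Θ)|, |Θ|, |p_cut(r,Θ)|` and the clamps. -/
theorem tz_abs_clampedRelEnergy_le {σ η₁ a b r Θ B : ℝ} {W : V3} (hab : a ≤ b) (hB : 0 ≤ B)
    (hW : ‖W‖ ≤ B) (hμ : |(cutEOS σ η₁).chemPotential r Θ| ≤ B) (hΘ : |Θ| ≤ B)
    (hp : |(cutEOS σ η₁).p r Θ| ≤ B) (U : BoxState) :
    |clampedRelEnergy σ η₁ a b r W Θ U| ≤
      (1 + 5 * B + B ^ 2 + B * max |a| |b|) * (1 + |U.1| + ‖U.2.1‖ + |U.2.2|) := by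
  rw [tz_clampedRelEnergy_eq]
  set ζ := clamp a b ((cutEOS σ η₁).s U.1 (2 * (U.2.2 - ‖U.2.1‖ ^ 2 / (2 * U.1)) / (3 * U.1)))
    with hζ
  set Zb := max |a| |b| with hZb
  have hZb0 : 0 ≤ Zb := (abs_nonneg a).trans (le_max_left _ _)
  have hζb : |ζ| ≤ Zb := abs_clamp_le hab _
  have h1 : |∑ i, U.2.1 i * W i| ≤ 3 * B * ‖U.2.1‖ := by
    calc |∑ i, U.2.1 i * W i| ≤ ∑ i, |U.2.1 i * W i| := Finset.abs_sum_le_sum_abs _ _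
      _ ≤ ∑ _i : Fin 3, ‖U.2.1‖ * B := Finset.sum_le_sum fun i _ => by
          rw [abs_mul]
          have hm : |U.2.1 i| ≤ ‖U.2.1‖ := Real.norm_eq_abs _ ▸ PiLp.norm_apply_le U.2.1 i
          have hw : |W i| ≤ B := (Real.norm_eq_abs _ ▸ PiLp.norm_apply_le W i).trans hW
          exact mul_le_mul hm hw (abs_nonneg _) (norm_nonneg _)
      _ = 3 * B * ‖U.2.1‖ := by simp; ring
  have h2 : |U.1 * (‖W‖ ^ 2 / 2 - (cutEOS σ η₁).chemPotential r Θ)| ≤ |U.1| * (B ^ 2 / 2 + B) := by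
    rw [abs_mul]
    refine mul_le_mul_of_nonneg_left ?_ (abs_nonneg _)
    have hW2 : ‖W‖ ^ 2 ≤ B ^ 2 := pow_le_pow_left₀ (norm_nonneg _) hW 2
    have := abs_le.1 hμ
    rw [abs_le]
    constructor <;> nlinarith [sq_nonneg ‖W‖]
  have h3 : |Θ * (U.1 * ζ)| ≤ B * Zb * |U.1| := by
    rw [abs_mul, abs_mul]
    calc |Θ| * (|U.1| * |ζ|) ≤ B * (|U.1| * Zb) :=
          mul_le_mul hΘ (mul_le_mul_of_nonneg_left hζb (abs_nonneg _)) (by positivity) hB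
      _ = B * Zb * |U.1| := by ring
  have a1 := abs_le.1 h1
  have a2 := abs_le.1 h2
  have a3 := abs_le.1 h3
  have a4 := abs_le.1 hp
  have hE1 := le_abs_self U.2.2
  have hE2 := neg_abs_le U.2.2
  have key : |U.2.2 - ∑ i, U.2.1 i * W i + U.1 * (‖W‖ ^ 2 / 2 - (cutEOS σ η₁).chemPotential r Θ) -
        Θ * (U.1 * ζ) + (cutEOS σ η₁).p r Θ| ≤
      |U.2.2| + 3 * B * ‖U.2.1‖ + |U.1| * (B ^ 2 / 2 + B) + B * Zb * |U.1| + B := by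
    rw [abs_le]; constructor <;> linarith
  refine key.trans ?_
  set C := 1 + 5 * B + B ^ 2 + B * Zb with hC
  have hBZ : 0 ≤ B * Zb := mul_nonneg hB hZb0
  have hB2 : 0 ≤ B ^ 2 := sq_nonneg B
  have e1 : |U.2.2| ≤ C * |U.2.2| := le_mul_of_one_le_left (abs_nonneg _) (by rw [hC]; nlinarith)
  have e2 : 3 * B * ‖U.2.1‖ ≤ C * ‖U.2.1‖ :=
    mul_le_mul_of_nonneg_right (by rw [hC]; nlinarith) (norm_nonneg _)
  have e3 : |U.1| * (B ^ 2 / 2 + B) + B * Zb * |U.1| ≤ C * |U.1| := by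
    have : |U.1| * (B ^ 2 / 2 + B) + B * Zb * |U.1| = (B ^ 2 / 2 + B + B * Zb) * |U.1| := by ring
    rw [this]
    exact mul_le_mul_of_nonneg_right (by rw [hC]; nlinarith) (abs_nonneg _)
  have e4 : B ≤ C := by rw [hC]; nlinarith
  have hCexp : C * (1 + |U.1| + ‖U.2.1‖ + |U.2.2|) = C + C * |U.1| + C * ‖U.2.1‖ + C * |U.2.2| := by
    ring
  rw [hCexp]
  linarith

/-- **Zero at the strong state.** For `r ≠ 0` and inactive clamp `a ≤ s_cut(r,Θ) ≤ b`, the clamped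
relative energy of the strong box state `(r, rW, E(r,W,Θ))` against `(r, W, Θ)` vanishes
(`μ = e − Θ s + p/r`, `e = 3Θ/2`). -/
theorem tz_clampedRelEnergy_self {σ η₁ a b r Θ : ℝ} (W : V3) (hr : r ≠ 0)
    (ha : a ≤ (cutEOS σ η₁).s r Θ) (hb : (cutEOS σ η₁).s r Θ ≤ b) :
    clampedRelEnergy σ η₁ a b r W Θ (r, r • W, totalEnergyDensity r W Θ) = 0 := by
  rw [tz_clampedRelEnergy_eq]
  dsimp only
  have hn : ‖r • W‖ ^ 2 = r ^ 2 * ‖W‖ ^ 2 := by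
    rw [norm_smul, mul_pow, Real.norm_eq_abs, sq_abs]
  have hT : 2 * (totalEnergyDensity r W Θ - ‖r • W‖ ^ 2 / (2 * r)) / (3 * r) = Θ := by
    rw [hn, totalEnergyDensity]
    field_simp
    ring
  have hS : ∑ i, (r • W) i * W i = r * ‖W‖ ^ 2 := by
    rw [EuclideanSpace.real_norm_sq_eq, Finset.mul_sum]
    refine Finset.sum_congr rfl fun i _ => ?_
    rw [PiLp.smul_apply, smul_eq_mul]
    ring
  rw [hT, clamp_eq_self ha hb, hS, EulerEOS.chemPotential, tz_e_eq, totalEnergyDensity]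
  field_simp
  ring

/-! ## Growth and smallness of the clamped relative energy -/

/-- **Growth in the deviation.** With `B` bounding the strong data at a point,
`|ℰ_Z(U | r,W,Θ)| ≤ K (1 + dev)`, `dev = |ρ̂ − r| + ‖m̂ − rW‖ + |Ê − E(r,W,Θ)|`, `K = K(B, a, b)`. -/
theorem tz_growth {σ η₁ a b r Θ B E₀ : ℝ} {W : V3} (hab : a ≤ b)
    (hB : ‖W‖ + |(cutEOS σ η₁).chemPotential r Θ| + |Θ| + |(cutEOS σ η₁).p r Θ| +
      (|r| + ‖r • W‖ + |E₀|) ≤ B)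
    (U : BoxState) :
    |clampedRelEnergy σ η₁ a b r W Θ U| ≤
      (1 + 5 * B + B ^ 2 + B * max |a| |b|) * (1 + B) *
        (1 + (|U.1 - r| + ‖U.2.1 - r • W‖ + |U.2.2 - E₀|)) := by
  have n1 := norm_nonneg W
  have n2 := abs_nonneg ((cutEOS σ η₁).chemPotential r Θ)
  have n3 := abs_nonneg Θ
  have n4 := abs_nonneg ((cutEOS σ η₁).p r Θ)
  have n5 := abs_nonneg r
  have n6 := norm_nonneg (r • W)
  have n7 := abs_nonneg E₀
  have hB0 : 0 ≤ B := by linarith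
  have h := tz_abs_clampedRelEnergy_le (σ := σ) (η₁ := η₁) (r := r) (Θ := Θ) (W := W) hab hB0
    (by linarith) (by linarith) (by linarith) (by linarith) U
  refine h.trans ?_
  have hC0 : 0 ≤ 1 + 5 * B + B ^ 2 + B * max |a| |b| := by
    have : 0 ≤ max |a| |b| := (abs_nonneg a).trans (le_max_left _ _)
    positivity
  have d1 := abs_sub_abs_le_abs_sub U.1 r
  have d2 := norm_sub_norm_le U.2.1 (r • W)
  have d3 := abs_sub_abs_le_abs_sub U.2.2 E₀
  have e1 := abs_nonneg (U.1 - r)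
  have e2 := norm_nonneg (U.2.1 - r • W)
  have e3 := abs_nonneg (U.2.2 - E₀)
  have h2 : 1 + |U.1| + ‖U.2.1‖ + |U.2.2| ≤
      (1 + B) * (1 + (|U.1 - r| + ‖U.2.1 - r • W‖ + |U.2.2 - E₀|)) := by
    nlinarith
  rw [mul_assoc]
  exact mul_le_mul_of_nonneg_left h2 hC0

/-- **From growth and local smallness to `ε + K'·dev`.** -/
theorem tz_eps_linear {X Y : Type*} {f : X × Y → ℝ} {dev : X → Y → ℝ} {K δ ε : ℝ} (hK : 0 ≤ K)
    (hδ : 0 < δ) (hε : 0 ≤ ε) (hdev : ∀ x y, 0 ≤ dev x y)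
    (hgrowth : ∀ x y, |f (x, y)| ≤ K * (1 + dev x y))
    (hsmall : ∀ x y, dev x y ≤ δ → |f (x, y)| < ε) (x : X) (y : Y) :
    |f (x, y)| ≤ ε + (K / δ + K) * dev x y := by
  have hd := hdev x y
  have hKδ : 0 ≤ K / δ := div_nonneg hK hδ.le
  by_cases h : dev x y ≤ δ
  · have := hsmall x y h
    nlinarith
  · have h' : δ < dev x y := not_le.1 h
    have h1 : K ≤ K / δ * dev x y := by
      rw [div_mul_eq_mul_div, le_div_iff₀ hδ]
      exact mul_le_mul_of_nonneg_left h'.le hK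
    have h2 := hgrowth x y
    nlinarith

/-- The sup distance of box states is dominated by the `ℓ¹` deviation. -/
theorem tz_dist_le_dev (U V : BoxState) :
    dist U V ≤ |U.1 - V.1| + ‖U.2.1 - V.2.1‖ + |U.2.2 - V.2.2| := by
  rw [Prod.dist_eq, Prod.dist_eq, Real.dist_eq, Real.dist_eq, dist_eq_norm]
  have h1 := abs_nonneg (U.1 - V.1)
  have h2 := norm_nonneg (U.2.1 - V.2.1)
  have h3 := abs_nonneg (U.2.2 - V.2.2)
  exact max_le (by linarith) (max_le (by linarith) (by linarith))

/-! ## Continuity at the strong state -/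

/-- Under the EOS fact the cut pressure is continuous along continuous positive strong data. -/
theorem tz_continuous_p {η₀ η₁ σ : ℝ} {F : ℝ → ℝ}
    (hF : AnalyticOnNhd ℝ F (Ioo (-η₀) η₀)) (hEq : EqOn hsExcessFreeEnergy F (Ico 0 η₀))
    (hη₁ : 0 < η₁) (hη₁₀ : η₁ < η₀) (hσ : 0 < σ) {ρ₀ θ₀ : T3 → ℝ} (hρ : Continuous ρ₀)
    (hθ : Continuous θ₀) (hρ0 : ∀ x, 0 < ρ₀ x) :
    Continuous fun x => (cutEOS σ η₁).p (ρ₀ x) (θ₀ x) := by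
  have hZ : Continuous fun x => cutCompressibility η₁ (ρ₀ x * σ ^ 3) :=
    (cc_continuousOn_cutCompressibility hF hEq hη₁ hη₁₀).comp_continuous (hρ.mul continuous_const)
      fun x => mul_pos (hρ0 x) (pow_pos hσ 3)
  simp only [tz_p_eq]
  exact (hρ.mul hθ).mul hZ

/-- **Continuity of `(x, U) ↦ ℰ_Z(U | (ρ₀,u₀,θ₀)(x))` at the strong box state over `x`** (clamp, `s_cut`
continuous near the strong thermal state in the open quadrant; `ρ₀ x > 0` keeps `ρ̂ ↦ |m̂|²/ρ̂, ϑ̂` regular). -/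
theorem tz_continuousAt {σ η₁ a b : ℝ} {ρ₀ θ₀ : T3 → ℝ} {u₀ : T3 → V3}
    (hu : Continuous u₀) (hθ : Continuous θ₀)
    (hsC : ContinuousOn (fun q : ℝ × ℝ => (cutEOS σ η₁).s q.1 q.2) (Ioi 0 ×ˢ Ioi 0))
    (hμC : Continuous fun x => (cutEOS σ η₁).chemPotential (ρ₀ x) (θ₀ x))
    (hpC : Continuous fun x => (cutEOS σ η₁).p (ρ₀ x) (θ₀ x))
    {x : T3} (hρx : 0 < ρ₀ x) (hθx : 0 < θ₀ x) :
    ContinuousAt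
      (fun p : T3 × BoxState => clampedRelEnergy σ η₁ a b (ρ₀ p.1) (u₀ p.1) (θ₀ p.1) p.2)
      (x, (ρ₀ x, ρ₀ x • u₀ x, totalEnergyDensity (ρ₀ x) (u₀ x) (θ₀ x))) := by
  simp only [tz_clampedRelEnergy_eq]
  have hne : ρ₀ x ≠ 0 := hρx.ne'
  -- the box temperature `ϑ̂(U) = 2(Ê − |m̂|²/(2ρ̂))/(3ρ̂)`
  have hT : ContinuousAt (fun p : T3 × BoxState =>
      2 * (p.2.2.2 - ‖p.2.2.1‖ ^ 2 / (2 * p.2.1)) / (3 * p.2.1))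
      (x, (ρ₀ x, ρ₀ x • u₀ x, totalEnergyDensity (ρ₀ x) (u₀ x) (θ₀ x))) := by
    fun_prop (disch := exact mul_ne_zero (by norm_num) hne)
  have hTval : 2 * (totalEnergyDensity (ρ₀ x) (u₀ x) (θ₀ x) - ‖ρ₀ x • u₀ x‖ ^ 2 / (2 * ρ₀ x)) /
      (3 * ρ₀ x) = θ₀ x := by
    rw [norm_smul, mul_pow, Real.norm_eq_abs, sq_abs, totalEnergyDensity]
    field_simp
    ring
  have hsAt : ContinuousAt (fun q : ℝ × ℝ => (cutEOS σ η₁).s q.1 q.2) (ρ₀ x, θ₀ x) :=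
    hsC.continuousAt ((isOpen_Ioi.prod isOpen_Ioi).mem_nhds ⟨hρx, hθx⟩)
  have h1 : ContinuousAt (fun p : T3 × BoxState => p.2.1)
      (x, (ρ₀ x, ρ₀ x • u₀ x, totalEnergyDensity (ρ₀ x) (u₀ x) (θ₀ x))) := by fun_prop
  have hs : ContinuousAt (fun p : T3 × BoxState => (cutEOS σ η₁).s p.2.1
      (2 * (p.2.2.2 - ‖p.2.2.1‖ ^ 2 / (2 * p.2.1)) / (3 * p.2.1)))
      (x, (ρ₀ x, ρ₀ x • u₀ x, totalEnergyDensity (ρ₀ x) (u₀ x) (θ₀ x))) :=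
    ContinuousAt.comp_of_eq hsAt (h1.prodMk hT) (by rw [Prod.mk.injEq]; exact ⟨rfl, hTval⟩)
  have hZ : ContinuousAt (fun p : T3 × BoxState => clamp a b ((cutEOS σ η₁).s p.2.1
      (2 * (p.2.2.2 - ‖p.2.2.1‖ ^ 2 / (2 * p.2.1)) / (3 * p.2.1))))
      (x, (ρ₀ x, ρ₀ x • u₀ x, totalEnergyDensity (ρ₀ x) (u₀ x) (θ₀ x))) :=
    (continuous_clamp a b).continuousAt.comp hs
  have hA : Continuous fun p : T3 × BoxState => p.2.2.2 - ∑ i, p.2.2.1 i * u₀ p.1 i +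
      p.2.1 * (‖u₀ p.1‖ ^ 2 / 2 - (cutEOS σ η₁).chemPotential (ρ₀ p.1) (θ₀ p.1)) := by
    have hμ' : Continuous fun p : T3 × BoxState => (cutEOS σ η₁).chemPotential (ρ₀ p.1) (θ₀ p.1) :=
      hμC.comp continuous_fst
    fun_prop
  have hθ' : Continuous fun p : T3 × BoxState => θ₀ p.1 := hθ.comp continuous_fst
  have hp' : Continuous fun p : T3 × BoxState => (cutEOS σ η₁).p (ρ₀ p.1) (θ₀ p.1) :=
    hpC.comp continuous_fst
  exact ((hA.continuousAt.sub (hθ'.continuousAt.mul (h1.mul hZ))).add hp'.continuousAt)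

/-! ## Uniform smallness near a compact graph -/

/-- **Uniform continuity at a compact graph.** If `f : X × Y → ℝ` vanishes and is continuous at every
point of the graph of a continuous `g : X → Y`, `X` compact, then `|f(x, y)| < ε` uniformly for `y`
within some `δ > 0` of `g x`. -/
theorem tz_uniform_small {X Y : Type*} [PseudoMetricSpace X] [CompactSpace X] [PseudoMetricSpace Y]
    {f : X × Y → ℝ} {g : X → Y} (hg : Continuous g) (hf : ∀ x, ContinuousAt f (x, g x))
    (hf0 : ∀ x, f (x, g x) = 0) {ε : ℝ} (hε : 0 < ε) :
    ∃ δ : ℝ, 0 < δ ∧ ∀ x y, dist y (g x) ≤ δ → |f (x, y)| < ε := by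
  set K : Set (X × Y) := range fun x => (x, g x) with hK
  have hKc : IsCompact K := isCompact_range (continuous_id.prodMk hg)
  have hsub : K ⊆ interior {p : X × Y | |f p| < ε} := by
    rintro _ ⟨x, rfl⟩
    rw [mem_interior_iff_mem_nhds]
    have h2 := (hf x).preimage_mem_nhds (Metric.ball_mem_nhds (f (x, g x)) hε)
    refine Filter.mem_of_superset h2 fun p hp => ?_
    simpa only [mem_preimage, Metric.mem_ball, Real.dist_eq, hf0, sub_zero, mem_setOf_eq] using hp
  obtain ⟨δ, hδ, hthick⟩ := hKc.exists_cthickening_subset_open isOpen_interior hsub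
  refine ⟨δ, hδ, fun x y hy => ?_⟩
  have hmem : (x, y) ∈ Metric.cthickening δ K := by
    refine Metric.mem_cthickening_of_dist_le (x, y) (x, g x) δ K (mem_range_self x) ?_
    rw [Prod.dist_eq, dist_self]
    exact max_le hδ.le hy
  have hV : (x, y) ∈ {p : X × Y | |f p| < ε} := interior_subset (hthick hmem)
  exact hV

/-! ## The pointwise estimate -/

/-- **The deterministic heart of S1'.** Under `HsEosLowDensity` (threshold `η₀ =: ηa`), for a band
`η₁ < ηa`, `σ > 0`, a classical hard-sphere Euler solution on `[0,T)`, `0 < T`, and clamps admissible at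
`τ = 0`: for every `ε > 0` there is `K' ≥ 0` with
`|ℰ_{Z_{a,b}}(U | (ρ,u,θ)(0,x))| ≤ ε + K' (|ρ̂ − ρ| + ‖m̂ − ρu‖ + |Ê − E(ρ,u,θ)|)(0,x)` for ALL `x ∈ 𝕋³` and ALL
`U = (ρ̂, m̂, Ê)`. Proof: `(x, U) ↦ ℰ_Z` vanishes (`tz_clampedRelEnergy_self`, clamp inactive) and is continuous
(`tz_continuousAt`) at the compact graph of the strong box state, so it is `ε`-small within a uniform `δ'`
(`tz_uniform_small`); away from it the linear growth bound `tz_growth` is absorbed into `K'/δ'`. -/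
theorem tz_pointwise_estimate :
    HsEosLowDensity →
      ∃ ηa : ℝ, 0 < ηa ∧ ∀ η₁ : ℝ, 0 < η₁ → η₁ < ηa → ∀ σ : ℝ, 0 < σ →
        ∀ (T : ℝ) (ρ θ : ℝ → T3 → ℝ) (u : ℝ → T3 → V3), IsHardSphereEulerSolution σ T ρ u θ → 0 < T →
          ∀ a b : ℝ, ClampAdmissible σ η₁ a b ρ θ 0 →
            ∀ ε : ℝ, 0 < ε → ∃ K' : ℝ, 0 ≤ K' ∧ ∀ (x : T3) (U : BoxState),
              |clampedRelEnergy σ η₁ a b (ρ 0 x) (u 0 x) (θ 0 x) U| ≤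
                ε + K' * (|U.1 - ρ 0 x| + ‖U.2.1 - ρ 0 x • u 0 x‖ +
                  |U.2.2 - totalEnergyDensity (ρ 0 x) (u 0 x) (θ 0 x)|) := by
  rintro ⟨η₀, hη₀, F, hF, hEq, -, -, -⟩
  refine ⟨η₀, hη₀, ?_⟩
  intro η₁ hη₁ hη₁a σ hσ T ρ θ u hsol hT a b hadm ε hε
  -- the strong data at time `0`
  have h0T : (0 : ℝ) ∈ Ico 0 T := ⟨le_rfl, hT⟩
  have hρc : Continuous (ρ 0) := (hsol.smooth_density.isSmooth_slice h0T).continuous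
  have huc : Continuous (u 0) := (hsol.smooth_velocity.isSmooth_slice h0T).continuous
  have hθc : Continuous (θ 0) := (hsol.smooth_temperature.isSmooth_slice h0T).continuous
  have hρ0 : ∀ x, 0 < ρ 0 x := hsol.density_pos 0 h0T
  have hθ0 : ∀ x, 0 < θ 0 x := hsol.temperature_pos 0 h0T
  have hEc : Continuous fun x => totalEnergyDensity (ρ 0 x) (u 0 x) (θ 0 x) := by
    unfold totalEnergyDensity; fun_prop
  -- admissible clamps at `τ = 0`: `a < s_cut < b` at the strong thermal states
  obtain ⟨hab, ⟨δ, hδ, hbox⟩, -⟩ := hadm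
  have hsin : ∀ x, a ≤ (cutEOS σ η₁).s (ρ 0 x) (θ 0 x) ∧ (cutEOS σ η₁).s (ρ 0 x) (θ 0 x) ≤ b := by
    intro x
    have h := hbox 0 ⟨le_rfl, le_rfl⟩ x (ρ 0 x) (θ 0 x) (by simp [hδ.le]) (by simp [hδ.le])
    exact ⟨h.2.2.2.1.le, h.2.2.2.2.le⟩
  -- continuity of the cut law along the strong data (the only use of the EOS fact)
  have hsC := cc_continuousOn_s (σ := σ) hF hEq hη₁ hη₁a hσ
  have hμC : Continuous fun x => (cutEOS σ η₁).chemPotential (ρ 0 x) (θ 0 x) :=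
    (cc_continuousOn_chemPotential hF hEq hη₁ hη₁a hσ).comp_continuous (hρc.prodMk hθc)
      fun x => ⟨hρ0 x, hθ0 x⟩
  have hpC : Continuous fun x => (cutEOS σ η₁).p (ρ 0 x) (θ 0 x) :=
    tz_continuous_p hF hEq hη₁ hη₁a hσ hρc hθc hρ0
  -- a uniform bound on the strong data over the compact torus
  obtain ⟨B, hB⟩ : ∃ B : ℝ, ∀ x, ‖u 0 x‖ + |(cutEOS σ η₁).chemPotential (ρ 0 x) (θ 0 x)| + |θ 0 x| +
      |(cutEOS σ η₁).p (ρ 0 x) (θ 0 x)| + (|ρ 0 x| + ‖ρ 0 x • u 0 x‖ +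
      |totalEnergyDensity (ρ 0 x) (u 0 x) (θ 0 x)|) ≤ B := by
    have hcont : Continuous fun x => ‖u 0 x‖ + |(cutEOS σ η₁).chemPotential (ρ 0 x) (θ 0 x)| +
        |θ 0 x| + |(cutEOS σ η₁).p (ρ 0 x) (θ 0 x)| + (|ρ 0 x| + ‖ρ 0 x • u 0 x‖ +
        |totalEnergyDensity (ρ 0 x) (u 0 x) (θ 0 x)|) := by
      fun_prop
    obtain ⟨B, hB⟩ := isCompact_univ.exists_bound_of_continuousOn hcont.continuousOn
    exact ⟨B, fun x => (le_abs_self _).trans (Real.norm_eq_abs _ ▸ hB x (mem_univ x))⟩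
  have hB0 : 0 ≤ B := by
    have h := hB 0
    have : 0 ≤ ‖u 0 0‖ + |(cutEOS σ η₁).chemPotential (ρ 0 0) (θ 0 0)| + |θ 0 0| +
        |(cutEOS σ η₁).p (ρ 0 0) (θ 0 0)| + (|ρ 0 0| + ‖ρ 0 0 • u 0 0‖ +
        |totalEnergyDensity (ρ 0 0) (u 0 0) (θ 0 0)|) := by positivity
    linarith
  -- growth, zero and continuity at the strong box state, uniformly in `x`
  have hZb : 0 ≤ max |a| |b| := (abs_nonneg a).trans (le_max_left _ _)
  have hK0 : 0 ≤ (1 + 5 * B + B ^ 2 + B * max |a| |b|) * (1 + B) := by positivity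
  have hgrowth : ∀ (x : T3) (U : BoxState),
      |(fun p : T3 × BoxState => clampedRelEnergy σ η₁ a b (ρ 0 p.1) (u 0 p.1) (θ 0 p.1) p.2) (x, U)| ≤
        (1 + 5 * B + B ^ 2 + B * max |a| |b|) * (1 + B) * (1 + (|U.1 - ρ 0 x| +
          ‖U.2.1 - ρ 0 x • u 0 x‖ + |U.2.2 - totalEnergyDensity (ρ 0 x) (u 0 x) (θ 0 x)|)) :=
    fun x U => tz_growth hab.le (hB x) U
  have hzero : ∀ x : T3, (fun p : T3 × BoxState =>
      clampedRelEnergy σ η₁ a b (ρ 0 p.1) (u 0 p.1) (θ 0 p.1) p.2)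
      (x, (ρ 0 x, ρ 0 x • u 0 x, totalEnergyDensity (ρ 0 x) (u 0 x) (θ 0 x))) = 0 :=
    fun x => tz_clampedRelEnergy_self (u 0 x) (hρ0 x).ne' (hsin x).1 (hsin x).2
  have hcAt := fun x : T3 => tz_continuousAt (a := a) (b := b) huc hθc hsC hμC hpC (hρ0 x) (hθ0 x)
  have hU₀c : Continuous fun x : T3 =>
      ((ρ 0 x, ρ 0 x • u 0 x, totalEnergyDensity (ρ 0 x) (u 0 x) (θ 0 x)) : BoxState) :=
    hρc.prodMk ((hρc.smul huc).prodMk hEc)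
  -- assemble
  obtain ⟨δ', hδ', hsmall⟩ := tz_uniform_small hU₀c hcAt hzero hε
  refine ⟨_, by positivity, fun x U => tz_eps_linear (f := fun p : T3 × BoxState =>
    clampedRelEnergy σ η₁ a b (ρ 0 p.1) (u 0 p.1) (θ 0 p.1) p.2)
    (dev := fun (x : T3) (U : BoxState) => |U.1 - ρ 0 x| + ‖U.2.1 - ρ 0 x • u 0 x‖ +
      |U.2.2 - totalEnergyDensity (ρ 0 x) (u 0 x) (θ 0 x)|)
    hK0 hδ' hε.le (fun x U => by positivity) hgrowth (fun x U hU => hsmall x U ?_) x U⟩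
  exact (tz_dist_le_dev U _).trans hU

end Summit.AtomisticToContinuum.HydrodynamicLimit.Theorems.RES

end
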